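import Summits.SmoothPoincare4.SmoothPoincare4.Theorems.ConvexBisectionAcyclicBisectionExistsPicardLefschetzVariation
import Literature.AlgebraicTopology.SingularHomology.HurewiczOne
import HarnessLib

/-!
# The crossing number of a page loop factors through `H₁` of the page
(wave 3, brick Z6-1 of the missing lemma `crossingNumber_eq_stdSymp` of node N1a
`node_M3c_shadow_pageDehnTwist` (Picard–Lefschetz on shadows) of stub `stub_modelsOnFibred_of_reach`
= NF4, line `modp-braid-orbits`, crux `ConvexBisection.AcyclicBisectionExists`, item
stmt-SmoothPoincare4-10508; registered sub-goal `helper_crossingNumber_factors_page`)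

The crossing number `crossingNumber φ K = wind (phaseLoop φ K)` of a loop `K` of the page
`page g c` with the framed page curve presented by an annulus chart `φ`
(`…PicardLefschetzPieces.lean`) is the winding number of the PHASE `exp (2πi χ(height φ ·))`
along `K`.  This file shows that the phase is a continuous map of the PAGE to `ℂ ∖ 0`
(`phaseFn`, `continuousOn_phaseFn`, `pagePhase`), so that the crossing number is the winding
functional `windH : H₁(ℂ ∖ 0; ℤ) → ℂ` (`HurewiczOne.lean`) evaluated on the push-forward of the
Hurewicz class of `K` IN THE PAGE:

* §1 `phaseFn`, `phaseFn_eq_one_of_not_mem_collar`, `continuousWithinAt_height` (the transverse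
  coordinate is continuous on the page at points of the open annulus: relative openness of the
  chart, `chart_relOpen`), **`continuousOn_phaseFn`**;
* §2 `pagePhase : ↥(page g c) → ℂ ∖ 0` and **`windH_map_pagePhase_loopClass`**:
  `windH ((pagePhase)_* h[K]) = 2πi · crossingNumber φ K`, `h[K] ∈ H₁(page g c; ℤ)` the Hurewicz
  class of the unit-period loop of `K` co-restricted to the page;
* §3 consequences — the crossing number FACTORS THROUGH `H₁(page g c; ℤ)` AS A HOMOMORPHISM:
  `crossingNumber_eq_of_loopClass_eq` (equal classes in the page ⇒ equal crossing numbers),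
  `crossingNumber_eq_sum_of_loopClass_eq` (`h[K] = Σ nᵢ h[Kᵢ] ⇒ crossingNumber φ K = Σ nᵢ
  crossingNumber φ Kᵢ`), `crossingNumber_eq_zero_of_loopClass_eq_zero`; free-homotopy invariance
  inside the page (`crossingNumber_eq_of_homotopic`, `crossingNumber_eq_of_family`), reversal
  (`crossingNumber_eq_neg_of_reverse`), and the vanishing on loops of constant height, in
  particular on the core curve `a` itself (`crossingNumber_core_eq_zero`);
* §4 the registered form `helper_crossingNumber_factors_page`.

Everything is proved; no named facts, no `sorry`.  References: A. Hatcher, *Algebraic Topology*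
(2002), Thm. 2A.1 and §1.1 Thm. 1.7 [HatcherAT2002]; B. Farb, D. Margalit, *A primer on mapping
class groups* (2012), §6.1 (algebraic intersection with a curve is a class function) [FarbMargalit2012].
-/

noncomputable section

set_option linter.dupNamespace false

open scoped Manifold ContDiff Topology Real
open Set Function Metric Filter
open Literature.Topology.FourManifolds Literature.Topology.FourManifolds.LefschetzBase
  Literature.AlgebraicTopology.SingularHomology Literature.AlgebraicTopology.FundamentalGroup.PuncturedPlane
  Literature.Topology.PlaneTopology

namespace Summit.SmoothPoincare4.SmoothPoincare4.Theorems.AcyclicBisectionExists.ModpBraidOrbits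

variable {g : ℕ} {c : ℂ} {φ : ℝ × ℝ → Base g}
  {K K₁ K₂ : sphere (0 : EuclideanSpace ℝ (Fin 2)) 1 → Base g}

/-! ## §1 The phase function and its continuity on the page -/

/-- **The phase** of a point of the base relative to the chart `φ`: `exp (2πi χ(height φ q))`, a
unit complex number (`1` off the collar). [folklore] -/
def phaseFn (φ : ℝ × ℝ → Base g) (q : Base g) : ℂ :=
  Complex.exp (((2 * π * clampStep (height φ q) : ℝ) : ℂ) * Complex.I)

/-- The phase loop of `K` is the phase along `t ↦ K (e^{2πit})`. [folklore] -/
theorem phaseLoop_apply (t : ℝ) : phaseLoop φ K t = phaseFn φ (K (circlePt t)) := rfl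

/-- The phase never vanishes. [folklore] -/
theorem phaseFn_ne_zero (q : Base g) : phaseFn φ q ≠ 0 := Complex.exp_ne_zero _

/-- Off the closed collar `φ(ℝ × [−1/2, 1/2])` the phase is `1`. [folklore] -/
theorem phaseFn_eq_one_of_not_mem_collar {q : Base g}
    (hqB : q ∉ φ '' (univ ×ˢ Icc (-(1 / 2) : ℝ) (1 / 2))) : phaseFn φ q = 1 :=
  phaseLoop_eq_one_of_not_mem_collar (K := fun _ => q) (t := 0) hqB

/-- **The transverse coordinate is continuous on the page at every point of the open annulus**
(the chart is relatively open into the page, `chart_relOpen`). [folklore] -/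
theorem continuousWithinAt_height (hc : ‖c‖ = 1) (hφc : Continuous φ)
    (hφ1 : ∀ u r, φ (u + 1, r) = φ (u, r)) (hφp : ∀ p, φ p ∈ page g c)
    (hφi : InjOn φ (Ico (0 : ℝ) 1 ×ˢ Ioo (-1 : ℝ) 1)) {q₀ : Base g}
    (hq₀ : q₀ ∈ φ '' (univ ×ˢ Ioo (-1 : ℝ) 1)) : ContinuousWithinAt (height φ) (page g c) q₀ := by
  obtain ⟨p₀, ⟨-, hp₀⟩, rfl⟩ := hq₀
  rw [ContinuousWithinAt, Metric.tendsto_nhds]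
  intro ε hε
  have hN : (univ ×ˢ Ioo (-1 : ℝ) 1) ∩ Prod.snd ⁻¹' ball p₀.2 ε ∈ 𝓝 p₀ :=
    inter_mem ((isOpen_univ.prod isOpen_Ioo).mem_nhds ⟨trivial, hp₀⟩)
      (continuous_snd.continuousAt.preimage_mem_nhds (ball_mem_nhds _ hε))
  obtain ⟨O, hO, hOsub⟩ := chart_relOpen hc hφc hφ1 hφp hφi hp₀ hN
  filter_upwards [mem_nhdsWithin_of_mem_nhds hO, self_mem_nhdsWithin] with q hqO hq
  obtain ⟨p, ⟨⟨-, hp⟩, hpε⟩, rfl⟩ := hOsub q hqO hq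
  rw [height_of_lift hφ1 hφi (u₀ := p.1) (r₀ := p.2) hp,
    height_of_lift hφ1 hφi (u₀ := p₀.1) (r₀ := p₀.2) hp₀]
  exact hpε

/-- **The phase is continuous on the page** (inside the open annulus through the transverse
coordinate; off it, the collar being compact, the phase is locally `1`). [folklore] -/
theorem continuousOn_phaseFn (hc : ‖c‖ = 1) (hφc : Continuous φ)
    (hφ1 : ∀ u r, φ (u + 1, r) = φ (u, r)) (hφp : ∀ p, φ p ∈ page g c)
    (hφi : InjOn φ (Ico (0 : ℝ) 1 ×ˢ Ioo (-1 : ℝ) 1)) : ContinuousOn (phaseFn φ) (page g c) := by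
  intro q₀ hq₀
  by_cases hA : q₀ ∈ φ '' (univ ×ˢ Ioo (-1 : ℝ) 1)
  · have h := continuousWithinAt_height hc hφc hφ1 hφp hφi hA
    have h2 : ContinuousWithinAt (fun q => ((2 * π * clampStep (height φ q) : ℝ) : ℂ) * Complex.I)
        (page g c) q₀ :=
      (Complex.continuous_ofReal.continuousAt.comp_continuousWithinAt
        (continuousWithinAt_const.mul
          (continuous_clampStep.continuousAt.comp_continuousWithinAt h))).mul
        continuousWithinAt_const
    exact Complex.continuous_exp.continuousAt.comp_continuousWithinAt h2
  · have hB : q₀ ∉ φ '' (univ ×ˢ Icc (-(1 / 2) : ℝ) (1 / 2)) := fun h =>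
      hA (image_mono (prod_mono Subset.rfl (Icc_subset_Ioo (by norm_num) (by norm_num))) h)
    have hV : IsOpen (φ '' (univ ×ˢ Icc (-(1 / 2) : ℝ) (1 / 2)))ᶜ :=
      (isCompact_collar hφc hφ1).isClosed.isOpen_compl
    refine ContinuousAt.continuousWithinAt ((continuousAt_const (y := (1 : ℂ))).congr ?_)
    filter_upwards [hV.mem_nhds hB] with q hq
    exact (phaseFn_eq_one_of_not_mem_collar hq).symm

/-! ## §2 The page phase map and the winding functional -/

/-- **The page phase map** `page g c → ℂ ∖ 0`, `q ↦ exp (2πi χ(height φ q))`. [folklore] -/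
def pagePhase (φ : ℝ × ℝ → Base g) (c : ℂ) (q : ↥(page g c)) : CStar :=
  ⟨phaseFn φ q.1, phaseFn_ne_zero _⟩

/-- The page phase map is continuous. [folklore] -/
theorem continuous_pagePhase (hc : ‖c‖ = 1) (hφc : Continuous φ)
    (hφ1 : ∀ u r, φ (u + 1, r) = φ (u, r)) (hφp : ∀ p, φ p ∈ page g c)
    (hφi : InjOn φ (Ico (0 : ℝ) 1 ×ˢ Ioo (-1 : ℝ) 1)) : Continuous (pagePhase φ c) :=
  Continuous.subtype_mk ((continuousOn_phaseFn hc hφc hφ1 hφp hφi).comp_continuous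
    continuous_subtype_val fun q => q.2) _

/-- The phase loop does not vanish. [folklore] -/
theorem phaseLoop_ne_zero (t : ℝ) : phaseLoop φ K t ≠ 0 := phaseFn_ne_zero _

/-- The phase loop closes up. [folklore] -/
theorem phaseLoop_zero_eq_one : phaseLoop φ K 0 = phaseLoop φ K 1 := by
  rw [phaseLoop_apply, phaseLoop_apply, ← circlePt_add_one 0, zero_add]

/-- **The crossing number is the winding functional on the push-forward by the page phase map of
the Hurewicz class of the loop in the page**:
`windH ((pagePhase)_* h[K]) = crossingNumber φ K · 2πi`. [cite: HatcherAT2002, Thm. 2A.1] -/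
theorem windH_map_pagePhase_loopClass (hc : ‖c‖ = 1) (hφc : Continuous φ)
    (hφ1 : ∀ u r, φ (u + 1, r) = φ (u, r)) (hφp : ∀ p, φ p ∈ page g c)
    (hφi : InjOn φ (Ico (0 : ℝ) 1 ×ˢ Ioo (-1 : ℝ) 1)) (hK : Continuous K)
    (hKc : ∀ θ, K θ ∈ page g c) :
    windH (singularHomology.map ℤ ℤ
        (⟨pagePhase φ c, continuous_pagePhase hc hφc hφ1 hφp hφi⟩ : C(↥(page g c), CStar)) 1
      (loopClass ℤ ℤ (1 : ℤ)
        (loopPath (fun θ => (⟨K θ, hKc θ⟩ : ↥(page g c))) (hK.subtype_mk hKc)))) =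
      (crossingNumber φ K : ℂ) * (2 * π * Complex.I) := by
  rw [map_loopClass, windH_loopClass]
  obtain ⟨l, hl, hle⟩ := hasLogOn_Icc (a := 0) (b := 1)
    (continuous_phaseLoop hc hφc hφ1 hφp hφi hK hKc).continuousOn fun t _ => phaseLoop_ne_zero t
  rw [edgeLog_eq hl fun t ht => by rw [edgeFun_ofPath _ ht, hle t ht]; rfl]
  rw [wind_spec hl hle phaseLoop_zero_eq_one, crossingNumber]

/-! ## §3 The crossing number factors through `H₁(page g c; ℤ)` -/

/-- **Page loops with the same Hurewicz class in `H₁(page g c; ℤ)` have the same crossing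
number.** [cite: FarbMargalit2012, §6.1] -/
theorem crossingNumber_eq_of_loopClass_eq (hc : ‖c‖ = 1) (hφc : Continuous φ)
    (hφ1 : ∀ u r, φ (u + 1, r) = φ (u, r)) (hφp : ∀ p, φ p ∈ page g c)
    (hφi : InjOn φ (Ico (0 : ℝ) 1 ×ˢ Ioo (-1 : ℝ) 1)) (hK₁ : Continuous K₁)
    (hK₁c : ∀ θ, K₁ θ ∈ page g c) (hK₂ : Continuous K₂) (hK₂c : ∀ θ, K₂ θ ∈ page g c)
    (h : loopClass ℤ ℤ (1 : ℤ) (loopPath (fun θ => (⟨K₁ θ, hK₁c θ⟩ : ↥(page g c)))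
        (hK₁.subtype_mk hK₁c)) =
      loopClass ℤ ℤ (1 : ℤ) (loopPath (fun θ => (⟨K₂ θ, hK₂c θ⟩ : ↥(page g c)))
        (hK₂.subtype_mk hK₂c))) :
    crossingNumber φ K₁ = crossingNumber φ K₂ := by
  apply int_eq_of_mul_two_pi_I_eq
  rw [← windH_map_pagePhase_loopClass hc hφc hφ1 hφp hφi hK₁ hK₁c, h,
    windH_map_pagePhase_loopClass hc hφc hφ1 hφp hφi hK₂ hK₂c]

/-- **Additivity**: if `h[K] = Σᵢ nᵢ h[Kᵢ]` in `H₁(page g c; ℤ)` then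
`crossingNumber φ K = Σᵢ nᵢ crossingNumber φ Kᵢ`. [cite: FarbMargalit2012, §6.1] -/
theorem crossingNumber_eq_sum_of_loopClass_eq (hc : ‖c‖ = 1) (hφc : Continuous φ)
    (hφ1 : ∀ u r, φ (u + 1, r) = φ (u, r)) (hφp : ∀ p, φ p ∈ page g c)
    (hφi : InjOn φ (Ico (0 : ℝ) 1 ×ˢ Ioo (-1 : ℝ) 1)) (hK : Continuous K)
    (hKc : ∀ θ, K θ ∈ page g c) {ι : Type*} (s : Finset ι) (n : ι → ℤ)
    (L : ι → sphere (0 : EuclideanSpace ℝ (Fin 2)) 1 → Base g) (hL : ∀ i, Continuous (L i))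
    (hLc : ∀ i θ, L i θ ∈ page g c)
    (h : loopClass ℤ ℤ (1 : ℤ) (loopPath (fun θ => (⟨K θ, hKc θ⟩ : ↥(page g c)))
        (hK.subtype_mk hKc)) =
      ∑ i ∈ s, n i • loopClass ℤ ℤ (1 : ℤ) (loopPath (fun θ => (⟨L i θ, hLc i θ⟩ : ↥(page g c)))
        ((hL i).subtype_mk (hLc i)))) :
    crossingNumber φ K = ∑ i ∈ s, n i * crossingNumber φ (L i) := by
  apply int_eq_of_mul_two_pi_I_eq
  rw [← windH_map_pagePhase_loopClass hc hφc hφ1 hφp hφi hK hKc, h, map_sum, map_sum,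
    Int.cast_sum, Finset.sum_mul]
  refine Finset.sum_congr rfl fun i _ => ?_
  rw [map_zsmul, map_zsmul, windH_map_pagePhase_loopClass hc hφc hφ1 hφp hφi (hL i) (hLc i),
    zsmul_eq_mul, Int.cast_mul]
  ring

/-- **A page loop null-homologous in the page has crossing number `0`.** [cite: FarbMargalit2012, §6.1] -/
theorem crossingNumber_eq_zero_of_loopClass_eq_zero (hc : ‖c‖ = 1) (hφc : Continuous φ)
    (hφ1 : ∀ u r, φ (u + 1, r) = φ (u, r)) (hφp : ∀ p, φ p ∈ page g c)
    (hφi : InjOn φ (Ico (0 : ℝ) 1 ×ˢ Ioo (-1 : ℝ) 1)) (hK : Continuous K)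
    (hKc : ∀ θ, K θ ∈ page g c)
    (h : loopClass ℤ ℤ (1 : ℤ) (loopPath (fun θ => (⟨K θ, hKc θ⟩ : ↥(page g c)))
        (hK.subtype_mk hKc)) = 0) :
    crossingNumber φ K = 0 := by
  have h' := crossingNumber_eq_sum_of_loopClass_eq hc hφc hφ1 hφp hφi hK hKc (∅ : Finset ℕ)
    (fun _ => 0) (fun _ => K) (fun _ => hK) (fun _ => hKc) (by rw [h, Finset.sum_empty])
  rwa [Finset.sum_empty] at h'

/-- **Homotopic page loops (homotopy inside the page) have the same crossing number.**
[cite: FarbMargalit2012, §6.1] -/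
theorem crossingNumber_eq_of_homotopic (hc : ‖c‖ = 1) (hφc : Continuous φ)
    (hφ1 : ∀ u r, φ (u + 1, r) = φ (u, r)) (hφp : ∀ p, φ p ∈ page g c)
    (hφi : InjOn φ (Ico (0 : ℝ) 1 ×ˢ Ioo (-1 : ℝ) 1)) (hK₁ : Continuous K₁)
    (hK₁c : ∀ θ, K₁ θ ∈ page g c) (hK₂ : Continuous K₂) (hK₂c : ∀ θ, K₂ θ ∈ page g c)
    (h : (⟨fun θ => (⟨K₁ θ, hK₁c θ⟩ : ↥(page g c)), hK₁.subtype_mk hK₁c⟩ :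
        C(sphere (0 : EuclideanSpace ℝ (Fin 2)) 1, ↥(page g c))).Homotopic
      ⟨fun θ => (⟨K₂ θ, hK₂c θ⟩ : ↥(page g c)), hK₂.subtype_mk hK₂c⟩) :
    crossingNumber φ K₁ = crossingNumber φ K₂ :=
  crossingNumber_eq_of_loopClass_eq hc hφc hφ1 hφp hφi hK₁ hK₁c hK₂ hK₂c
    (loopClass_int_loopPath_eq_of_homotopic _ _ h)

/-- **A family of page loops, jointly continuous on `[0, 1] × 𝕊¹`, has constant crossing number.**
[cite: FarbMargalit2012, §6.1] -/
theorem crossingNumber_eq_of_family (hc : ‖c‖ = 1) (hφc : Continuous φ)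
    (hφ1 : ∀ u r, φ (u + 1, r) = φ (u, r)) (hφp : ∀ p, φ p ∈ page g c)
    (hφi : InjOn φ (Ico (0 : ℝ) 1 ×ˢ Ioo (-1 : ℝ) 1))
    (H : ℝ → sphere (0 : EuclideanSpace ℝ (Fin 2)) 1 → Base g)
    (hH : ContinuousOn (uncurry H) (Icc (0 : ℝ) 1 ×ˢ univ))
    (hHc : ∀ s ∈ Icc (0 : ℝ) 1, ∀ θ, H s θ ∈ page g c)
    (hK₁ : Continuous K₁) (hK₂ : Continuous K₂) (e₁ : ∀ θ, H 0 θ = K₁ θ) (e₂ : ∀ θ, H 1 θ = K₂ θ) :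
    crossingNumber φ K₁ = crossingNumber φ K₂ := by
  have hK₁c : ∀ θ, K₁ θ ∈ page g c := fun θ => e₁ θ ▸ hHc 0 ⟨le_rfl, zero_le_one⟩ θ
  have hK₂c : ∀ θ, K₂ θ ∈ page g c := fun θ => e₂ θ ▸ hHc 1 ⟨zero_le_one, le_rfl⟩ θ
  refine crossingNumber_eq_of_homotopic hc hφc hφ1 hφp hφi hK₁ hK₁c hK₂ hK₂c ⟨?_⟩
  have hcont : Continuous fun p : unitInterval × sphere (0 : EuclideanSpace ℝ (Fin 2)) 1 =>
      H (p.1 : ℝ) p.2 :=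
    hH.comp_continuous ((continuous_subtype_val.comp continuous_fst).prodMk continuous_snd)
      fun p => ⟨p.1.2, mem_univ _⟩
  exact
    { toFun := fun p => ⟨H (p.1 : ℝ) p.2, hHc _ p.1.2 _⟩
      continuous_toFun := hcont.subtype_mk _
      map_zero_left := fun θ => Subtype.ext (e₁ θ)
      map_one_left := fun θ => Subtype.ext (e₂ θ) }

/-- **Reversing a page loop negates its crossing number.** [cite: FarbMargalit2012, §6.1] -/
theorem crossingNumber_eq_neg_of_reverse (hc : ‖c‖ = 1) (hφc : Continuous φ)
    (hφ1 : ∀ u r, φ (u + 1, r) = φ (u, r)) (hφp : ∀ p, φ p ∈ page g c)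
    (hφi : InjOn φ (Ico (0 : ℝ) 1 ×ˢ Ioo (-1 : ℝ) 1)) (hK₁ : Continuous K₁)
    (hK₁c : ∀ θ, K₁ θ ∈ page g c) (hK₂ : Continuous K₂) (hK₂c : ∀ θ, K₂ θ ∈ page g c)
    (h : ∀ t : ℝ, K₂ (circlePt t) = K₁ (circlePt (-t))) :
    crossingNumber φ K₂ = -crossingNumber φ K₁ := by
  have h' := crossingNumber_eq_sum_of_loopClass_eq hc hφc hφ1 hφp hφi hK₂ hK₂c {(0 : ℕ)}
    (fun _ => -1) (fun _ => K₁) (fun _ => hK₁) (fun _ => hK₁c) (by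
      rw [Finset.sum_singleton, neg_one_zsmul]
      exact stub_Kas_loopClass_reverse _ _ _ _ _ fun t => Subtype.ext (h t))
  rwa [Finset.sum_singleton, neg_one_mul] at h'

/-- **A loop along which the transverse coordinate is constant has crossing number `0`** (its
phase loop is constant). [folklore] -/
theorem crossingNumber_eq_zero_of_height_const {h₀ : ℝ}
    (h : ∀ t : ℝ, height φ (K (circlePt t)) = h₀) : crossingNumber φ K = 0 := by
  rw [crossingNumber, show phaseLoop φ K = fun _ => phaseFn φ (K (circlePt 0)) from
    funext fun t => by rw [phaseLoop_apply, phaseFn, phaseFn, h, h]]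
  exact wind_const _

/-- **The core curve of the chart does not cross itself**: `crossingNumber φ a = 0` for
`a = φ (·, 0)` (the transverse coordinate vanishes along `a`). [folklore] -/
theorem crossingNumber_core_eq_zero {a : sphere (0 : EuclideanSpace ℝ (Fin 2)) 1 → Base g}
    (hφ1 : ∀ u r, φ (u + 1, r) = φ (u, r)) (hφa : ∀ u, φ (u, 0) = a (circlePt u))
    (hφi : InjOn φ (Ico (0 : ℝ) 1 ×ˢ Ioo (-1 : ℝ) 1)) : crossingNumber φ a = 0 :=
  crossingNumber_eq_zero_of_height_const (h₀ := 0) fun t => by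
    rw [← hφa, height_of_lift hφ1 hφi (by norm_num)]

/-- **A page loop missing the closed collar has crossing number `0`.** [folklore] -/
theorem crossingNumber_eq_zero_of_not_mem_collar
    (h : ∀ t : ℝ, K (circlePt t) ∉ φ '' (univ ×ˢ Icc (-(1 / 2) : ℝ) (1 / 2))) :
    crossingNumber φ K = 0 := by
  rw [crossingNumber, show phaseLoop φ K = fun _ => (1 : ℂ) from
    funext fun t => phaseLoop_eq_one_of_not_mem_collar (h t)]
  exact wind_const _

/-! ## §4 The registered form -/

/-- **Sub-goal `helper_crossingNumber_factors_page`** (Z6-1 of the missing lemma of node N1a of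
NF4): the crossing number of a page loop with an annulus chart of its page factors through the
first homology of the page as a homomorphism — if the Hurewicz class in `H₁(page g c; ℤ)` of the
unit-period loop of `K` (co-restricted to the page) is the combination `Σᵢ nᵢ h[Lᵢ]` of the classes
of page loops `Lᵢ`, then `crossingNumber φ K = Σᵢ nᵢ · crossingNumber φ Lᵢ`.
[cite: FarbMargalit2012, §6.1] -/
theorem helper_crossingNumber_factors_page : ∀ (g : ℕ) (c : ℂ) (_hc : ‖c‖ = 1) (φ : ℝ × ℝ → Literature.Topology.FourManifolds.LefschetzBase.Base g) (_hφc : Continuous φ) (_hφ1 : ∀ u r, φ (u + 1, r) = φ (u, r)) (_hφp : ∀ p, φ p ∈ Literature.Topology.FourManifolds.LefschetzBase.page g c) (_hφi : Set.InjOn φ (Set.Ico (0 : ℝ) 1 ×ˢ Set.Ioo (-1 : ℝ) 1)) (K : Metric.sphere (0 : EuclideanSpace ℝ (Fin 2)) 1 → Literature.Topology.FourManifolds.LefschetzBase.Base g) (hK : Continuous K) (hKc : ∀ θ, K θ ∈ Literature.Topology.FourManifolds.LefschetzBase.page g c) (m : ℕ) (n : Fin m → ℤ) (L : Fin m → Metric.sphere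 (0 : EuclideanSpace ℝ (Fin 2)) 1 → Literature.Topology.FourManifolds.LefschetzBase.Base g) (hL : ∀ i, Continuous (L i)) (hLc : ∀ i θ, L i θ ∈ Literature.Topology.FourManifolds.LefschetzBase.page g c), Literature.AlgebraicTopology.SingularHomology.loopClass ℤ ℤ (1 : ℤ) (Literature.Topology.FourManifolds.LefschetzBase.loopPath (fun θ => (⟨K θ, hKc θ⟩ : ↥(Literature.Topology.FourManifolds.LefschetzBase.page g c))) (hK.subtype_mk hKc)) = ∑ i : Fin m, n i • Literature.AlgebraicTopology.SingularHomology.loopClass ℤ ℤ (1 : ℤ) (Literature.Topology.FourManifolds.LefschetzBase.loopPath (fun θ => (⟨L i θ, hLc i θ⟩ : ↥(Literature.Topology.FourManifolds.LefschetzBase.page g c))) ((hL i).subtype_mk (hLc i))) → Summit.SmoothPoincare4.SmoothPoincare4.Theorems.AcyclicBisectionExists.ModpBraidOrbits.crossingNumber φ K = ∑ i : Fin m, n i * Summit.SmoothPoincare4.SmoothPoincare4.Theorems.AcyclicBisectionExists.ModpBraidOrbits.crossingNumber φ (L i) :=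
  fun _ _ hc _ hφc hφ1 hφp hφi _ hK hKc _ n L hL hLc h =>
    crossingNumber_eq_sum_of_loopClass_eq hc hφc hφ1 hφp hφi hK hKc Finset.univ n L hL hLc h

end Summit.SmoothPoincare4.SmoothPoincare4.Theorems.AcyclicBisectionExists.ModpBraidOrbits

end
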